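import Literature.AlgebraicGeometry.HodgeTheory.HodgeClassesProductSpanCMSquare
import Literature.AlgebraicGeometry.HodgeTheory.WeilSurfaceCMSquare
import Literature.AlgebraicGeometry.HodgeTheory.WeilClassesHodgeType
import Literature.AlgebraicGeometry.HodgeTheory.AbelianVarietyMultiplicationPullback
import Literature.AlgebraicGeometry.HodgeTheory.RationalClassesIndependent
import Literature.AlgebraicGeometry.HodgeTheory.GysinFormalismHodgeOfGysin
import Literature.AlgebraicGeometry.Motives.AimedSplitProductCounterexampleClass
import Mathlib.LinearAlgebra.ExteriorPower.Basic
import Mathlib.Tactic.Module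
import HarnessLib

/-!
# Hodge classes of `E₁ × E₂` for CM elliptic curves with different CM fields are products

Family `hodge`, layer `Literature/AlgebraicGeometry/HodgeTheory`; theorem-only companion of
`HodgeGroupProductCMFactor` (the predicate `HodgeClassesProductSpan A C`: every rational
`(p,p)`-class of `A × C` lies in the span of the exterior products `pr₁^* a ∪ pr₂^* b` of rational
Hodge classes of the factors) and of `HodgeClassesProductSpanCMSquare` (its failure for the CM square
`E₀ × E₀`). Main result (`hodgeClassesProductSpan_cmCurves`): for complex abelian varieties `E₁, E₂`
of dimension `1` with `ψᵢ ≫ ψᵢ = -(dᵢ • 𝟙)` and `d₁ d₂` NOT a square — i.e. complex multiplication by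
the two DIFFERENT imaginary quadratic fields `ℚ(√-d₁) ≠ ℚ(√-d₂)` —

  `HodgeClassesProductSpan E₁ E₂`.

This is the `m = n = 1` instance, on the tree's carriers, of `Hg(E₁ × E₂) = Hg(E₁) × Hg(E₂)` for
non-isogenous elliptic curves (Imai; Moonen–Zarhin 1999 (3.9) "`X₁, …, X_r` elliptic curves, no two
of which are isogenous. Then `Hg(X) = Hg(X₁) × ⋯ × Hg(X_r)`", and (3.1): the Hodge group splits iff
all `B(X₁^m × X₂^n)` are generated by the factors) — equivalently `Hom(E₁, E₂) = 0`: the only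
candidates for non-product Hodge classes on a product of two curves sit in `H¹(E₁) ⊗ H¹(E₂)`, and a
rational `(1,1)`-class there is (Lefschetz (1,1) + Künneth) the class of a homomorphism. Together with
`not_hodgeClassesProductSpan_cmSquare` this gives both sides of the dichotomy "`Hom(X₁, X₂) ≠ 0`" of
Moonen–Zarhin §3 for CM elliptic curves (`exists_cmCurves_productSpan_and_not_productSpan`).

HONEST SCOPE: only the surface `E₁ × E₂` (`m = n = 1`) is treated — the statement for all powers
`E₁^m × E₂^n` (which is what is equivalent to the splitting of the Hodge group) is NOT proved here;
the hypothesis is "`d₁ d₂` is not a square", which for the tree's data `ψᵢ² = -dᵢ` is exactly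
`ℚ(√-d₁) ≠ ℚ(√-d₂)`; CM is used on both factors (it supplies the eigenbases — the statement for
arbitrary non-isogenous curves is not attempted). Research context of the cell `pub-hodge-ring2`: a
route conditional on HC_CM; this file is unconditional structure of Hodge classes and is not a step
towards a summit statement.

## Proof (carriers: `Hᵏ((E₁ × E₂)(ℂ); ℂ)`, pull-backs, cup products; no Hodge group is used)

§1 For one CM curve `(E, ψ)`, `T = ψ^*` on `H¹`, `s = i√d`: a rational `v ≠ 0`, the basis
`v, Tv`, and the eigenvectors `w± = Tv ± s v`, of PURE CONJUGATE Hodge types `(p,q)`, `(q,p)`,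
`p + q = 1` (`exists_cmCurve_eigenData`; purity: an eigenvector spanning its eigenline is of type
`(1,0)` or `(0,1)`, van Geemen's proof of Lemma 5.2, the tree's `isOfHodgeType_one_or_of_eigenvector`).
`H²(E)` consists of `(1,1)`-classes and `Hᵏ(E) = 0` for `k ≥ 3`.

§2 Slices `i₁ = (𝟙, 0)`, `i₂ = (0, 𝟙)`: `i₁^* pr₁^* = id`, `i₁^* pr₂^* = 0` on `H¹`; hence
`pr₁^*v₁, pr₁^*T₁v₁, pr₂^*v₂, pr₂^*T₂v₂` is a basis of `H¹(E₁ × E₂)` (`b₁ = 4`).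

§3 (the theorem) Künneth on the carriers: `H²(B) = E4 + E2 + E0` with `E4 = pr₁^*H²(E₁)`,
`E2 = span{pr₁^*a ∪ pr₂^*b}`, `E0 = pr₂^*H²(E₂)` (`H² = ⋀²H¹`, `HasExteriorCohomologyH1`), and the
RATIONAL operator `Ψ = [2] × [1]` acts on them by `4, 2, 1` (`[m]^* = mᵏ` on `Hᵏ`); so the three
components of a rational `(1,1)`-class `c` are rational polynomials in `Ψ^*` applied to `c`, hence
rational and (for `E2`) of type `(1,1)`. The `E4`-component is `pr₁^* a` with `a = i₁^*(…)` rational,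
of type `(1,1)` (top degree), i.e. the product class `pr₁^*a ∪ pr₂^*1`; likewise `E0`. THE HEART:
the `E2`-component `e` vanishes. With `R = (ψ₁ × ψ₂)^*` (`R(pr₁^*a ∪ pr₂^*b) = pr₁^*T₁a ∪ pr₂^*T₂b`)
and the four products `π±± = pr₁^*w₁± ∪ pr₂^*w₂±` spanning `E2`: `R π±± = (±s₁)(±s₂) π±±`; by Künneth
for Hodge types (`isOfHodgeType_cupProduct_map_fst_map_snd_of_multiplicative_deRham`, de Rham's
theorem) exactly two of the four are of type `(1,1)` — those with `R`-eigenvalue `μ = -s₁s₂` if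
`p₁ = p₂`, `μ = +s₁s₂` otherwise — and the other two are of types `(2,0)`, `(0,2)`. Writing
`e = Σ c±± π±±`, the class `Re - μe` is of type `(1,1)` and a combination of the two non-`(1,1)`
products, hence `0` (independence of the Hodge pieces, `IsOfHodgeType.add_eq_zero_of_ne`): `Re = μe`.
But `e` and `Re` are RATIONAL classes and `μ² = d₁d₂` is not the square of a rational: a non-zero
rational class cannot be a `μ`-eigenvector (`linearIndependent_iff_of_isRationalClass`), so `e = 0`.
Degrees `0` (`H⁰ = ℂ·1 = ℂ · pr₁^*1 ∪ pr₂^*1`), `4` (`H⁴` is the line through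
`pr₁^*(v₁∪T₁v₁) ∪ pr₂^*(v₂∪T₂v₂) ≠ 0`, non-vanishing by the determinant of the basis of §2 through
`⋀⁴H¹ ≅ H⁴`) and `≥ 6` (`= 0`) are the remaining, formal, cases.

Everything below is proved; no definition and no named fact is introduced (D-0026); axioms standard.
One `set_option maxHeartbeats` (the main proof is a single long structural argument).

## References

* [MoonenZarhin1999LowDim] B. Moonen, Yu. Zarhin, Hodge classes on abelian varieties of low
  dimension, Math. Ann. 315 (1999) 711–733 (arXiv:math/9901113), §3 (3.1), Thm. (3.2) (Hazama),
  Cor. (3.9) (Imai).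
* [vanGeemen1994HodgeAV] B. van Geemen, An introduction to the Hodge conjecture for abelian
  varieties, LNM 1594 (1994), 3.5–3.7, 5.3 and proof of Lemma 5.2.
* [VoisinHodgeI2002] C. Voisin, Hodge Theory and Complex Algebraic Geometry I (2002), Thm. 6.18,
  Cor. 6.14, §7.3.2, Thm. 11.38 (Künneth and Hodge types).
* [LangeBirkenhake1992] H. Lange, Ch. Birkenhake, Complex Abelian Varieties (1992), §1.1,
  Lemma 1.1.17, Exercise 1.1.6 (7)–(8).
* [HatcherAT2002] A. Hatcher, Algebraic Topology (2002), §3.1 Thm. 3.2, §3.2 Prop. 3.10, Thm. 3.11.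
-/

noncomputable section

open CategoryTheory MonoidalCategory CartesianMonoidalCategory
open Literature.AlgebraicTopology.SingularHomology
open Literature.AlgebraicGeometry.Motives

namespace Literature.AlgebraicGeometry.HodgeTheory

/-! ### §1 One CM curve: the rational basis `v, Tv` and the pure eigenvectors `w± = Tv ± s v` -/

section Curve

variable {E : AbelianVariety ℂ} {d : ℕ} {ψ : E ⟶ E}

/-- **Eigen-data of a CM curve.** For `dim E = 1`, `ψ ≫ ψ = -d`, `d ≥ 1`, `T = ψ^*` on `H¹`,
`s = i√d`: there is a rational `v ≠ 0` with `v, Tv` independent, and the eigenvectors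
`w₊ = Tv + s v` (`T w₊ = s w₊`), `w₋ = Tv - s v` (`T w₋ = -s w₋`) are of PURE, CONJUGATE Hodge types
`(p, q)`, `(q, p)`, `p + q = 1` (purity of eigenvectors spanning their eigenline,
`isOfHodgeType_one_or_of_eigenvector`; `w₋ = conj w₊`). [cite: vanGeemen1994HodgeAV, proof of Lemma 5.2]
[cite: VoisinHodgeI2002, §7.3.2 and Cor. 6.14] -/
theorem exists_cmCurve_eigenData (hE : E.dim = 1) (hd : 0 < d) (hψ : ψ ≫ ψ = -(d • 𝟙 E)) :
    ∃ v : complexBetti E.X 1, IsRationalClass v ∧ v ≠ 0 ∧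
      LinearIndependent ℂ ![v, (complexBetti.map ψ.hom.hom.hom 1).hom v] ∧
      ∃ p q : ℕ, p + q = 1 ∧
        IsOfHodgeType 1 E.X 1 p q ((complexBetti.map ψ.hom.hom.hom 1).hom v +
          (Complex.I * (Real.sqrt d : ℂ)) • v) ∧
        IsOfHodgeType 1 E.X 1 q p ((complexBetti.map ψ.hom.hom.hom 1).hom v -
          (Complex.I * (Real.sqrt d : ℂ)) • v) := by
  classical
  have hX : Motives.IsSmoothProjective 1 E.X := isSmoothProjective_of_dim_eq' hE
  set T := (complexBetti.map ψ.hom.hom.hom 1).hom with hTdef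
  have hT2 : ∀ c, T (T c) = -((d : ℂ) • c) := fun c ↦ complexBetti_map_map_one_of_comp_self hψ c
  set s : ℂ := Complex.I * (Real.sqrt d : ℂ) with hs
  have hs2 : s * s = -(d : ℂ) := by rw [← sq, hs, I_mul_sqrt_sq]
  have hs0 : s ≠ 0 := I_mul_sqrt_ne_zero hd
  obtain ⟨v, hv, hv0⟩ := exists_isRationalClass_ne_zero_one hE
  have hTv : IsRationalClass (T v) := hv.map _
  have hli : LinearIndependent ℂ ![v, T v] := linearIndependent_pair_map_one hd hψ hv hv0
  set wp : complexBetti E.X 1 := T v + s • v with hwp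
  set wm : complexBetti E.X 1 := T v - s • v with hwm
  have hTwp : T wp = s • wp := by
    rw [hwp, map_add, map_smul, hT2, smul_add, smul_smul, hs2, neg_smul, add_comm]
  have hwp0 : wp ≠ 0 := by
    intro h
    have h' : s • v + (1 : ℂ) • T v = 0 := by rw [one_smul, add_comm]; exact h
    exact hs0 (LinearIndependent.pair_iff.1 hli s 1 h').1
  have hconj : conjClass (Motives.ComplexPoints E.X) 1 wp = wm := by
    rw [hwp, hwm, conjClass_add, conjClass_smul, hTv.conjClass_eq, hv.conjClass_eq, hs]
    simp only [map_mul, Complex.conj_I, Complex.conj_ofReal]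
    rw [neg_mul, neg_smul, sub_eq_add_neg]
  have hline : ∀ c' : complexBetti E.X 1, complexBetti.map ψ.hom.hom.hom 1 c' = s • c' →
      ∃ t : ℂ, c' = t • wp := by
    intro c' hc'
    haveI : Module.Finite ℂ (complexBetti E.X 1) := finite_complexBetti_abelianVariety E 1
    have hdim : Module.finrank ℂ (Module.End.eigenspace T s) = 1 := by
      have h := two_mul_finrank_eigenspace_eq hd hψ
      rw [finrank_complexBetti_one_of_dim_eq_one hE] at h
      change 2 * Module.finrank ℂ (Module.End.eigenspace T s) = 2 at h
      omega
    have hwpmem : wp ∈ Module.End.eigenspace T s := Module.End.mem_eigenspace_iff.2 hTwp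
    have hc'mem : c' ∈ Module.End.eigenspace T s := Module.End.mem_eigenspace_iff.2 hc'
    have hne : (⟨wp, hwpmem⟩ : Module.End.eigenspace T s) ≠ 0 := fun h ↦
      hwp0 (congrArg Subtype.val h)
    obtain ⟨t, ht⟩ := (finrank_eq_one_iff_of_nonzero' _ hne).1 hdim ⟨c', hc'mem⟩
    exact ⟨t, (congrArg Subtype.val ht).symm⟩
  have hpure : IsOfHodgeType 1 E.X 1 1 0 wp ∨ IsOfHodgeType 1 E.X 1 0 1 wp :=
    isOfHodgeType_one_or_of_eigenvector hX ψ.hom.hom.hom s hTwp hline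
  refine ⟨v, hv, hv0, hli, ?_⟩
  rcases hpure with h | h
  · refine ⟨1, 0, rfl, h, ?_⟩
    have h' := h.conjClass hX
    rw [hconj] at h'
    exact h'
  · refine ⟨0, 1, rfl, h, ?_⟩
    have h' := h.conjClass hX
    rw [hconj] at h'
    exact h' 

/-- **Every top-degree class of the curve is of type `(1,1)`** (`H^{2n} = H^{n,n}`). [cite: VoisinHodgeI2002, Cor. 6.14] -/
theorem isOfHodgeType_two_of_dim_eq_one (hE : E.dim = 1) (a : complexBetti E.X 2) :
    IsOfHodgeType E.dim E.X 2 1 1 a := by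
  rw [hE]
  obtain ⟨M⟩ := nonempty_hodgeModel_holds (isSmoothProjective_of_dim_eq' hE)
  exact Motives.EisensteinCounterexample.isOfHodgeType_top M a

/-- `Hᵏ(E(ℂ); ℂ) = 0` for `k ≥ 3` and `dim E = 1` (`b₁ = 2`, `H• = ⋀• H¹`). [cite: LangeBirkenhake1992, §1.1] -/
theorem complexBetti_eq_zero_of_dim_eq_one (hE : E.dim = 1) {k : ℕ} (hk : 3 ≤ k)
    (a : complexBetti E.X k) : a = 0 := by
  haveI : Module.Finite ℂ (complexBetti E.X 1) := finite_complexBetti_abelianVariety E 1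
  have hΛ := surface_hasExteriorCohomologyH1 E
  haveI := hΛ.subsingleton_of_lt (d := k) (by rw [finrank_complexBetti_one_of_dim_eq_one hE]; omega)
  exact Subsingleton.elim _ _

end Curve

/-! ### §2 Two curves: slices, the unit class, and membership in the span of product classes -/

section TwoCurves

variable {E₁ E₂ : AbelianVariety ℂ}

/-- A generator of `hodgeProductClasses A C p`, scaled, lies in the span (the interface between the
product scheme `(A.prod C).X` and `A.X ⊗ C.X`, definitionally equal). [cite: MoonenZarhin1999LowDim, §3] -/
theorem smul_cupProduct_mem_span_hodgeProductClasses {A C : AbelianVariety ℂ} {p l k : ℕ}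
    (hlk : 2 * l + 2 * k = 2 * p) {a : complexBetti A.X (2 * l)} {b : complexBetti C.X (2 * k)}
    (ha : IsRationalClass a) (ha' : IsOfHodgeType A.dim A.X (2 * l) l l a)
    (hb : IsRationalClass b) (hb' : IsOfHodgeType C.dim C.X (2 * k) k k b) (t : ℂ) :
    t • cupProduct (X := Motives.ComplexPoints (A.X ⊗ C.X)) hlk
        ((complexBetti.map (AbelianVariety.fst A C).hom.hom.hom (2 * l)).hom a)
        ((complexBetti.map (AbelianVariety.snd A C).hom.hom.hom (2 * k)).hom b) ∈
      Submodule.span ℂ (hodgeProductClasses A C p) :=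
  Submodule.smul_mem _ t (Submodule.subset_span ⟨l, k, hlk, a, b, ha, ha', hb, hb', rfl⟩)

/-- `i₁^* ∘ pr₁^* = id` for the slice `i₁ = (𝟙, 0) : E₁ → E₁ × E₂`. [folklore] -/
theorem sliceLeft_map_fst {k : ℕ} (a : complexBetti E₁.X k) :
    (complexBetti.map (AbelianVariety.prodLift (𝟙 E₁) (0 : E₁ ⟶ E₂)).hom.hom.hom k).hom
        ((complexBetti.map (AbelianVariety.fst E₁ E₂).hom.hom.hom k).hom a) = a := by
  change singularCohomology.map ℂ ℂ _ k (singularCohomology.map ℂ ℂ _ k a) = a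
  rw [abelianVarietyHom_map_map_apply, AbelianVariety.prodLift_fst]
  change complexBetti.map (𝟙 E₁.X) k a = a
  rw [complexBetti.map_id]
  rfl

/-- `i₁^* ∘ pr₂^* = 0` on `H¹` for the slice `i₁ = (𝟙, 0)` (`0^* = 0` on `H¹`). [folklore] -/
theorem sliceLeft_map_snd_one (b : complexBetti E₂.X 1) :
    (complexBetti.map (AbelianVariety.prodLift (𝟙 E₁) (0 : E₁ ⟶ E₂)).hom.hom.hom 1).hom
        ((complexBetti.map (AbelianVariety.snd E₁ E₂).hom.hom.hom 1).hom b) = 0 := by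
  change singularCohomology.map ℂ ℂ _ 1 (singularCohomology.map ℂ ℂ _ 1 b) = 0
  rw [abelianVarietyHom_map_map_apply, AbelianVariety.prodLift_snd]
  change (complexBetti.map (0 : E₁ ⟶ E₂).hom.hom.hom 1).hom b = 0
  rw [complexBetti_map_zero_one]
  rfl

/-- `i₂^* ∘ pr₂^* = id` for the slice `i₂ = (0, 𝟙) : E₂ → E₁ × E₂`. [folklore] -/
theorem sliceRight_map_snd {k : ℕ} (b : complexBetti E₂.X k) :
    (complexBetti.map (AbelianVariety.prodLift (0 : E₂ ⟶ E₁) (𝟙 E₂)).hom.hom.hom k).hom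
        ((complexBetti.map (AbelianVariety.snd E₁ E₂).hom.hom.hom k).hom b) = b := by
  change singularCohomology.map ℂ ℂ _ k (singularCohomology.map ℂ ℂ _ k b) = b
  rw [abelianVarietyHom_map_map_apply, AbelianVariety.prodLift_snd]
  change complexBetti.map (𝟙 E₂.X) k b = b
  rw [complexBetti.map_id]
  rfl

/-- `i₂^* ∘ pr₁^* = 0` on `H¹` for the slice `i₂ = (0, 𝟙)`. [folklore] -/
theorem sliceRight_map_fst_one (a : complexBetti E₁.X 1) :
    (complexBetti.map (AbelianVariety.prodLift (0 : E₂ ⟶ E₁) (𝟙 E₂)).hom.hom.hom 1).hom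
        ((complexBetti.map (AbelianVariety.fst E₁ E₂).hom.hom.hom 1).hom a) = 0 := by
  change singularCohomology.map ℂ ℂ _ 1 (singularCohomology.map ℂ ℂ _ 1 a) = 0
  rw [abelianVarietyHom_map_map_apply, AbelianVariety.prodLift_fst]
  change (complexBetti.map (0 : E₂ ⟶ E₁).hom.hom.hom 1).hom a = 0
  rw [complexBetti_map_zero_one]
  rfl

/-- `pr₁^* x₁ ∪ pr₂^* y₂, pr₁^* x₁' ∪ …`: **four independent degree-one classes on `E₁ × E₂`**: if
`x, x'` are independent in `H¹(E₁)` and `y, y'` in `H¹(E₂)`, then `pr₁^*x, pr₁^*x', pr₂^*y, pr₂^*y'`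
are independent in `H¹(E₁ × E₂)` (restrict to the two slices). [cite: LangeBirkenhake1992, §1.1] -/
theorem linearIndependent_map_fst_map_snd {x x' : complexBetti E₁.X 1} {y y' : complexBetti E₂.X 1}
    (hx : LinearIndependent ℂ ![x, x']) (hy : LinearIndependent ℂ ![y, y']) :
    LinearIndependent ℂ
      ![(complexBetti.map (AbelianVariety.fst E₁ E₂).hom.hom.hom 1).hom x,
        (complexBetti.map (AbelianVariety.fst E₁ E₂).hom.hom.hom 1).hom x',
        (complexBetti.map (AbelianVariety.snd E₁ E₂).hom.hom.hom 1).hom y,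
        (complexBetti.map (AbelianVariety.snd E₁ E₂).hom.hom.hom 1).hom y'] := by
  set X := (complexBetti.map (AbelianVariety.fst E₁ E₂).hom.hom.hom 1).hom with hX
  set Y := (complexBetti.map (AbelianVariety.snd E₁ E₂).hom.hom.hom 1).hom with hY
  rw [Fintype.linearIndependent_iff]
  intro g hg
  rw [Fin.sum_univ_four] at hg
  change g 0 • X x + g 1 • X x' + g 2 • Y y + g 3 • Y y' = 0 at hg
  set I₁ := (complexBetti.map (AbelianVariety.prodLift (𝟙 E₁) (0 : E₁ ⟶ E₂)).hom.hom.hom 1).hom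
  set I₂ := (complexBetti.map (AbelianVariety.prodLift (0 : E₂ ⟶ E₁) (𝟙 E₂)).hom.hom.hom 1).hom
  have h₁ := congrArg I₁ hg
  rw [map_add, map_add, map_add, map_smul, map_smul, map_smul, map_smul, map_zero, hX, hY,
    sliceLeft_map_fst, sliceLeft_map_fst, sliceLeft_map_snd_one, sliceLeft_map_snd_one, smul_zero,
    smul_zero, add_zero, add_zero] at h₁
  have h₂ := congrArg I₂ hg
  rw [map_add, map_add, map_add, map_smul, map_smul, map_smul, map_smul, map_zero, hX, hY,
    sliceRight_map_snd, sliceRight_map_snd, sliceRight_map_fst_one, sliceRight_map_fst_one, smul_zero,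
    smul_zero, zero_add, zero_add] at h₂
  have hx' := Fintype.linearIndependent_iff.1 hx ![g 0, g 1] (by
    rw [Fin.sum_univ_two]
    exact h₁)
  have hy' := Fintype.linearIndependent_iff.1 hy ![g 2, g 3] (by
    rw [Fin.sum_univ_two]
    exact h₂)
  intro i
  fin_cases i
  · exact hx' 0
  · exact hx' 1
  · exact hy' 0
  · exact hy' 1

end TwoCurves

/-! ### §3 The theorem -/

section Main

variable {E₁ E₂ : AbelianVariety ℂ} {d₁ d₂ : ℕ} {ψ₁ : E₁ ⟶ E₁} {ψ₂ : E₂ ⟶ E₂}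

set_option maxHeartbeats 1600000 in
-- one long structural proof (Künneth pieces, two eigen-decompositions, four Hodge-type cases)
/-- **The Hodge classes of `E₁ × E₂` are spanned by products of Hodge classes of the factors, for CM
elliptic curves with different CM fields.** For complex abelian varieties `E₁, E₂` of dimension `1`
with `ψᵢ ≫ ψᵢ = -(dᵢ • 𝟙)` and `d₁ d₂` not a square (`ℚ(√-d₁) ≠ ℚ(√-d₂)`, so `Hom(E₁, E₂) = 0`):
`HodgeClassesProductSpan E₁ E₂` — the `m = n = 1` case of `Hg(E₁ × E₂) = Hg(E₁) × Hg(E₂)` (Imai;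
Moonen–Zarhin (3.9), (3.1)). Proof: module docstring (Künneth pieces separated by `([2] × [1])^*`;
on `pr₁^*H¹ ∪ pr₂^*H¹` the `(1,1)`-classes form an eigenspace of `(ψ₁ × ψ₂)^*` with the irrational
eigenvalue `∓√d₁√d₂`, which carries no non-zero rational class).
[cite: MoonenZarhin1999LowDim, §3 (3.1) and Cor. (3.9)] [cite: vanGeemen1994HodgeAV, proof of Lemma 5.2] -/
theorem hodgeClassesProductSpan_cmCurves (hE₁ : E₁.dim = 1) (hE₂ : E₂.dim = 1)
    (hψ₁ : ψ₁ ≫ ψ₁ = -(d₁ • 𝟙 E₁)) (hψ₂ : ψ₂ ≫ ψ₂ = -(d₂ • 𝟙 E₂)) (hsq : ¬ IsSquare (d₁ * d₂)) :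
    HodgeClassesProductSpan E₁ E₂ := by
  classical
  -- `d₁, d₂ ≥ 1`
  have hd₁ : 0 < d₁ := Nat.pos_of_ne_zero (by rintro rfl; exact hsq ⟨0, by simp⟩)
  have hd₂ : 0 < d₂ := Nat.pos_of_ne_zero (by rintro rfl; exact hsq ⟨0, by simp⟩)
  -- the product surface `B = E₁ × E₂`
  have hX₁ : Motives.IsSmoothProjective 1 E₁.X := isSmoothProjective_of_dim_eq' hE₁
  have hX₂ : Motives.IsSmoothProjective 1 E₂.X := isSmoothProjective_of_dim_eq' hE₂
  have hBdim : (E₁.prod E₂).dim = 1 + 1 := by rw [AbelianVariety.dim_prod, hE₁, hE₂]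
  have hB : Motives.IsSmoothProjective (1 + 1) (E₁.prod E₂).X := isSmoothProjective_of_dim_eq' hBdim
  have hΛ := surface_hasExteriorCohomologyH1 (E₁.prod E₂)
  haveI hfin : ∀ k, Module.Finite ℂ (complexBetti (E₁.prod E₂).X k) := fun k ↦
    finite_complexBetti_abelianVariety (E₁.prod E₂) k
  have hb1 : Module.finrank ℂ (complexBetti (E₁.prod E₂).X 1) = 4 := by
    rw [surface_finrank_complexBetti_one, hBdim]
  -- eigen-data of the two curves
  obtain ⟨v₁, hv₁, hv₁0, hli₁, p₁, q₁, hpq₁, hwp₁, hwm₁⟩ := exists_cmCurve_eigenData hE₁ hd₁ hψ₁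
  obtain ⟨v₂, hv₂, hv₂0, hli₂, p₂, q₂, hpq₂, hwp₂, hwm₂⟩ := exists_cmCurve_eigenData hE₂ hd₂ hψ₂
  set T₁ := (complexBetti.map ψ₁.hom.hom.hom 1).hom with hT₁
  set T₂ := (complexBetti.map ψ₂.hom.hom.hom 1).hom with hT₂
  have hT₁2 : ∀ c, T₁ (T₁ c) = -((d₁ : ℂ) • c) := fun c ↦ complexBetti_map_map_one_of_comp_self hψ₁ c
  have hT₂2 : ∀ c, T₂ (T₂ c) = -((d₂ : ℂ) • c) := fun c ↦ complexBetti_map_map_one_of_comp_self hψ₂ c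
  set s₁ : ℂ := Complex.I * (Real.sqrt d₁ : ℂ) with hs₁
  set s₂ : ℂ := Complex.I * (Real.sqrt d₂ : ℂ) with hs₂
  have hs₁2 : s₁ * s₁ = -(d₁ : ℂ) := by rw [← sq, hs₁, I_mul_sqrt_sq]
  have hs₂2 : s₂ * s₂ = -(d₂ : ℂ) := by rw [← sq, hs₂, I_mul_sqrt_sq]
  have hs₁0 : s₁ ≠ 0 := I_mul_sqrt_ne_zero hd₁
  have hs₂0 : s₂ ≠ 0 := I_mul_sqrt_ne_zero hd₂
  -- pull-backs along the projections, in degrees 1 and 2, and the cup product `H¹ × H¹ → H²` of `B`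
  set X1 := (complexBetti.map (AbelianVariety.fst E₁ E₂).hom.hom.hom 1).hom with hX1
  set Y1 := (complexBetti.map (AbelianVariety.snd E₁ E₂).hom.hom.hom 1).hom with hY1
  set X2 := (complexBetti.map (AbelianVariety.fst E₁ E₂).hom.hom.hom 2).hom with hX2
  set Y2 := (complexBetti.map (AbelianVariety.snd E₁ E₂).hom.hom.hom 2).hom with hY2
  set P := cupProduct (X := Motives.ComplexPoints (E₁.prod E₂).X) (R := ℂ) (rfl : 1 + 1 = 2) with hP
  set P₁ := cupProduct (X := Motives.ComplexPoints E₁.X) (R := ℂ) (rfl : 1 + 1 = 2) with hP₁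
  set P₂ := cupProduct (X := Motives.ComplexPoints E₂.X) (R := ℂ) (rfl : 1 + 1 = 2) with hP₂
  have hPXX : ∀ a a', P (X1 a) (X1 a') = X2 (P₁ a a') := fun a a' ↦ (cupProduct_map _ rfl a a').symm
  have hPYY : ∀ b b', P (Y1 b) (Y1 b') = Y2 (P₂ b b') := fun b b' ↦ (cupProduct_map _ rfl b b').symm
  have hPYX : ∀ a b, P (Y1 b) (X1 a) = -P (X1 a) (Y1 b) := fun a b ↦ by
    have h := cupProduct_gradedComm_holds ℂ (Motives.ComplexPoints (E₁.prod E₂).X) (rfl : 1 + 1 = 2)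
      rfl (Y1 b) (X1 a)
    simp only [mul_one, pow_one, neg_smul, one_smul] at h
    exact h
  -- a basis of `H¹(B)`: `X1 v₁, X1 T₁v₁, Y1 v₂, Y1 T₂v₂`
  have hliB : LinearIndependent ℂ ![X1 v₁, X1 (T₁ v₁), Y1 v₂, Y1 (T₂ v₂)] :=
    linearIndependent_map_fst_map_snd hli₁ hli₂
  have hcard : Fintype.card (Fin 4) = Module.finrank ℂ (complexBetti (E₁.prod E₂).X 1) := by
    rw [Fintype.card_fin, hb1]
  let bB := basisOfLinearIndependentOfCardEqFinrank hliB hcard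
  have hbB : ∀ j, bB j = ![X1 v₁, X1 (T₁ v₁), Y1 v₂, Y1 (T₂ v₂)] j := fun j ↦ by
    rw [coe_basisOfLinearIndependentOfCardEqFinrank]
  -- `H¹(B) = pr₁^* H¹(E₁) + pr₂^* H¹(E₂)`
  have hdec1 : ∀ u : complexBetti (E₁.prod E₂).X 1, ∃ (a : complexBetti E₁.X 1) (b : complexBetti E₂.X 1),
      u = X1 a + Y1 b := by
    intro u
    have hu := bB.sum_repr u
    rw [Fin.sum_univ_four, hbB, hbB, hbB, hbB] at hu
    change bB.repr u 0 • X1 v₁ + bB.repr u 1 • X1 (T₁ v₁) + bB.repr u 2 • Y1 v₂ +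
      bB.repr u 3 • Y1 (T₂ v₂) = u at hu
    refine ⟨bB.repr u 0 • v₁ + bB.repr u 1 • T₁ v₁, bB.repr u 2 • v₂ + bB.repr u 3 • T₂ v₂, ?_⟩
    rw [map_add, map_smul, map_smul, map_add, map_smul, map_smul, ← add_assoc]
    exact hu.symm
  -- the Künneth pieces of `H²(B)`
  set E4 : Submodule ℂ (complexBetti (E₁.prod E₂).X 2) := LinearMap.range X2 with hE4
  set E0 : Submodule ℂ (complexBetti (E₁.prod E₂).X 2) := LinearMap.range Y2 with hE0
  set E2 : Submodule ℂ (complexBetti (E₁.prod E₂).X 2) :=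
    Submodule.span ℂ {x | ∃ (a : complexBetti E₁.X 1) (b : complexBetti E₂.X 1), x = P (X1 a) (Y1 b)}
    with hE2
  have hP2 : ∀ w : Fin 2 → complexBetti (E₁.prod E₂).X 1,
      cupPowOne ℂ (Motives.ComplexPoints (E₁.prod E₂).X) 2 w = P (w 0) (w 1) := by
    intro w
    rw [cupPowOne_succ, Fin.tail_def]
    simp only [cupPowOne_one]
    rfl
  have hdec2 : ∀ w : complexBetti (E₁.prod E₂).X 2, ∃ e4 ∈ E4, ∃ e2 ∈ E2, ∃ e0 ∈ E0,
      w = e4 + e2 + e0 := by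
    have hle : Submodule.span ℂ (Set.range (cupPowOne ℂ (Motives.ComplexPoints (E₁.prod E₂).X) 2)) ≤
        E4 ⊔ E2 ⊔ E0 := by
      refine Submodule.span_le.2 ?_
      rintro _ ⟨u, rfl⟩
      obtain ⟨a, b, hu0⟩ := hdec1 (u 0)
      obtain ⟨a', b', hu1⟩ := hdec1 (u 1)
      rw [hP2 u, hu0, hu1]
      simp only [map_add, LinearMap.add_apply]
      rw [hPXX, hPYY, hPYX]
      refine Submodule.add_mem _ (Submodule.add_mem _ ?_ ?_) (Submodule.add_mem _ ?_ ?_)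
      · exact Submodule.mem_sup_left (Submodule.mem_sup_left ⟨_, rfl⟩)
      · exact Submodule.mem_sup_left (Submodule.mem_sup_right
          (Submodule.neg_mem _ (Submodule.subset_span ⟨a', b, rfl⟩)))
      · exact Submodule.mem_sup_left (Submodule.mem_sup_right (Submodule.subset_span ⟨a, b', rfl⟩))
      · exact Submodule.mem_sup_right ⟨_, rfl⟩
    rw [hΛ.span_range_cupPowOne 2, top_le_iff] at hle
    intro w
    have hw : w ∈ E4 ⊔ E2 ⊔ E0 := by rw [hle]; exact Submodule.mem_top
    obtain ⟨y, hy, e0, he0, rfl⟩ := Submodule.mem_sup.1 hw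
    obtain ⟨e4, he4, e2, he2, rfl⟩ := Submodule.mem_sup.1 hy
    exact ⟨e4, he4, e2, he2, e0, he0, rfl⟩
  -- pull-backs along commuting squares: `f ≫ g = g ≫ h ⟹ f^* (g^* a) = g^* (h^* a)`
  have hcomm : ∀ {E : AbelianVariety ℂ} (f : E₁.prod E₂ ⟶ E₁.prod E₂) (g : E₁.prod E₂ ⟶ E)
      (h : E ⟶ E), f ≫ g = g ≫ h → ∀ (k : ℕ) (a : complexBetti E.X k),
      (complexBetti.map f.hom.hom.hom k).hom ((complexBetti.map g.hom.hom.hom k).hom a) =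
        (complexBetti.map g.hom.hom.hom k).hom ((complexBetti.map h.hom.hom.hom k).hom a) := by
    intro E f g h hfg k a
    have h1 := abelianVarietyHom_map_map_apply f g a
    rw [hfg, ← abelianVarietyHom_map_map_apply] at h1
    exact h1
  -- the rational operator `Ψ = [2] × [1]`: `Ψ^* = 4, 2, 1` on `E4, E2, E0`
  set Ψ : E₁.prod E₂ ⟶ E₁.prod E₂ :=
    AbelianVariety.prodLift ((2 : ℕ) • AbelianVariety.fst E₁ E₂) (AbelianVariety.snd E₁ E₂) with hΨ
  have hΨ1 : Ψ ≫ AbelianVariety.fst E₁ E₂ = AbelianVariety.fst E₁ E₂ ≫ ((2 : ℕ) • 𝟙 E₁) := by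
    rw [hΨ, AbelianVariety.prodLift_fst, Preadditive.comp_nsmul, Category.comp_id]
  have hΨ2 : Ψ ≫ AbelianVariety.snd E₁ E₂ = AbelianVariety.snd E₁ E₂ ≫ 𝟙 E₂ := by
    rw [hΨ, AbelianVariety.prodLift_snd, Category.comp_id]
  set F := (complexBetti.map Ψ.hom.hom.hom 2).hom with hF
  set F1 := (complexBetti.map Ψ.hom.hom.hom 1).hom with hF1
  have hid : ∀ {E : AbelianVariety ℂ} (k : ℕ) (a : complexBetti E.X k),
      (complexBetti.map (𝟙 E : E ⟶ E).hom.hom.hom k).hom a = a := fun k a ↦ abelianVariety_map_id_apply a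
  have hF1X : ∀ a, F1 (X1 a) = (2 : ℂ) • X1 a := fun a ↦ by
    rw [hF1, hX1, hcomm Ψ _ _ hΨ1 1 a]
    have h2 : (complexBetti.map ((2 : ℕ) • 𝟙 E₁ : E₁ ⟶ E₁).hom.hom.hom 1).hom a = (2 : ℂ) • a := by
      have h := complexBetti_map_nsmul_id_apply E₁ 2 1 a
      rw [pow_one, Nat.cast_ofNat] at h
      exact h
    rw [h2, map_smul]
  have hF1Y : ∀ b, F1 (Y1 b) = Y1 b := fun b ↦ by
    rw [hF1, hY1, hcomm Ψ _ _ hΨ2 1 b, hid]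
  have hFX2 : ∀ a, F (X2 a) = (4 : ℂ) • X2 a := fun a ↦ by
    rw [hF, hX2, hcomm Ψ _ _ hΨ1 2 a]
    have h2 : (complexBetti.map ((2 : ℕ) • 𝟙 E₁ : E₁ ⟶ E₁).hom.hom.hom 2).hom a = (4 : ℂ) • a := by
      have h := complexBetti_map_nsmul_id_apply E₁ 2 2 a
      rw [Nat.cast_ofNat] at h
      norm_num at h
      exact h
    rw [h2, map_smul]
  have hFY2 : ∀ b, F (Y2 b) = Y2 b := fun b ↦ by
    rw [hF, hY2, hcomm Ψ _ _ hΨ2 2 b, hid]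
  have hFP : ∀ a b, F (P (X1 a) (Y1 b)) = (2 : ℂ) • P (X1 a) (Y1 b) := fun a b ↦ by
    have h1 : F (P (X1 a) (Y1 b)) = P (F1 (X1 a)) (F1 (Y1 b)) := by
      rw [hF, hP, hF1]
      exact cupProduct_map (Motives.AlgPoints.mapContinuous (L := ℂ) Ψ.hom.hom.hom) rfl (X1 a) (Y1 b)
    rw [h1, hF1X, hF1Y, map_smul, LinearMap.smul_apply]
  have hF4 : ∀ e ∈ E4, F e = (4 : ℂ) • e := by
    rintro _ ⟨a, rfl⟩
    exact hFX2 a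
  have hF0 : ∀ e ∈ E0, F e = e := by
    rintro _ ⟨b, rfl⟩
    exact hFY2 b
  have hF2 : ∀ e ∈ E2, F e = (2 : ℂ) • e := by
    intro e he
    induction he using Submodule.span_induction with
    | mem x hx =>
      obtain ⟨a, b, rfl⟩ := hx
      exact hFP a b
    | zero => rw [map_zero, smul_zero]
    | add x y _ _ hx hy => rw [map_add, hx, hy, smul_add]
    | smul t x _ hx => rw [map_smul, hx, smul_comm]
  -- `Ψ^*` preserves rationality and Hodge types
  have hFrat : ∀ x : complexBetti (E₁.prod E₂).X 2, IsRationalClass x → IsRationalClass (F x) :=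
    fun x hx ↦ hx.map _
  have hFtype : ∀ {p q : ℕ} (x : complexBetti (E₁.prod E₂).X 2),
      IsOfHodgeType (1 + 1) (E₁.prod E₂).X 2 p q x → IsOfHodgeType (1 + 1) (E₁.prod E₂).X 2 p q (F x) :=
    fun x hx ↦ hx.map_of_isSmoothProjective hB hB Ψ.hom.hom.hom
  ------------------------------------------------------------------
  -- the cases `p = 0`, `p = 1`, `p = 2`, `p ≥ 3`
  ------------------------------------------------------------------
  intro p c hc hpp
  have hdimsum : E₁.dim + E₂.dim = 1 + 1 := by rw [hE₁, hE₂]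
  rw [hdimsum] at hpp
  change IsOfHodgeType (1 + 1) (E₁.prod E₂).X (2 * p) p p c at hpp
  change ↥(complexBetti (E₁.prod E₂).X (2 * p)) at c
  obtain ⟨M₁⟩ := nonempty_hodgeModel_holds (AbelianVariety.isSmoothProjective_holds (A := E₁))
  obtain ⟨M₂⟩ := nonempty_hodgeModel_holds (AbelianVariety.isSmoothProjective_holds (A := E₂))
  have hone₁ : IsRationalClass (singularCohomology.one ℂ (Motives.ComplexPoints E₁.X)) :=
    isRationalClass_one _
  have hone₂ : IsRationalClass (singularCohomology.one ℂ (Motives.ComplexPoints E₂.X)) :=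
    isRationalClass_one _
  have hone₁' : IsOfHodgeType E₁.dim E₁.X (2 * 0) 0 0 (singularCohomology.one ℂ (Motives.ComplexPoints E₁.X)) :=
    isOfHodgeType_zero_zero_zero M₁ _
  have hone₂' : IsOfHodgeType E₂.dim E₂.X (2 * 0) 0 0 (singularCohomology.one ℂ (Motives.ComplexPoints E₂.X)) :=
    isOfHodgeType_zero_zero_zero M₂ _
  rcases (by omega : p = 0 ∨ p = 1 ∨ p = 2 ∨ 3 ≤ p) with rfl | rfl | rfl | hp3
  · ----------------------------------------------------------------
    -- `p = 0`: `H⁰(B) = ℂ · 1` and `1 = pr₁^* 1 ∪ pr₂^* 1`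
    ----------------------------------------------------------------
    change ↥(complexBetti (E₁.prod E₂).X 0) at c
    have hrange : Set.range (cupPowOne ℂ (Motives.ComplexPoints (E₁.prod E₂).X) 0) =
        {singularCohomology.one ℂ (Motives.ComplexPoints (E₁.prod E₂).X)} := by
      ext x
      simp only [Set.mem_range, cupPowOne_zero, Set.mem_singleton_iff]
      exact ⟨fun ⟨_, h⟩ ↦ h.symm, fun h ↦ ⟨Fin.elim0, h.symm⟩⟩
    have hc1 : c ∈ Submodule.span ℂ {singularCohomology.one ℂ (Motives.ComplexPoints (E₁.prod E₂).X)} := by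
      rw [← hrange, hΛ.span_range_cupPowOne 0]
      exact Submodule.mem_top
    obtain ⟨t, rfl⟩ := Submodule.mem_span_singleton.1 hc1
    have hone : cupProduct (X := Motives.ComplexPoints (E₁.X ⊗ E₂.X)) (two_mul_add_two_mul 0 0)
        ((complexBetti.map (AbelianVariety.fst E₁ E₂).hom.hom.hom (2 * 0)).hom
          (singularCohomology.one ℂ (Motives.ComplexPoints E₁.X)))
        ((complexBetti.map (AbelianVariety.snd E₁ E₂).hom.hom.hom (2 * 0)).hom
          (singularCohomology.one ℂ (Motives.ComplexPoints E₂.X))) =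
        singularCohomology.one ℂ (Motives.ComplexPoints (E₁.prod E₂).X) := by
      change cupProduct (p := 0) (q := 0) (n := 0) _
        (singularCohomology.map ℂ ℂ _ 0 (singularCohomology.one ℂ _))
        (singularCohomology.map ℂ ℂ _ 0 (singularCohomology.one ℂ _)) = _
      rw [singularCohomology.map_one, singularCohomology.map_one]
      exact cupProduct_one _
    have h := smul_cupProduct_mem_span_hodgeProductClasses (two_mul_add_two_mul 0 0) hone₁ hone₁'
      hone₂ hone₂' t
    rw [hone] at h
    exact h
  · ----------------------------------------------------------------
    -- `p = 1`: `c = e4 + e2 + e0` along `H² = pr₁^*H² ⊕ (H¹ ⊗ H¹) ⊕ pr₂^*H²`; `e2 = 0`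
    ----------------------------------------------------------------
    change ↥(complexBetti (E₁.prod E₂).X 2) at c
    change IsOfHodgeType (1 + 1) (E₁.prod E₂).X 2 1 1 c at hpp
    obtain ⟨e4, he4, e2, he2, e0, he0, hce⟩ := hdec2 c
    have hFc : F c = (4 : ℂ) • e4 + (2 : ℂ) • e2 + e0 := by
      rw [hce, map_add, map_add, hF4 e4 he4, hF2 e2 he2, hF0 e0 he0]
    have hFFc : F (F c) = (16 : ℂ) • e4 + (4 : ℂ) • e2 + e0 := by
      rw [hFc, map_add, map_add, map_smul, map_smul, hF4 e4 he4, hF2 e2 he2, hF0 e0 he0, smul_smul,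
        smul_smul]
      norm_num
    -- the three components are RATIONAL polynomials in `Ψ^*` applied to `c`
    have he2eq : e2 = (((-1 / 2 : ℚ) : ℂ)) • (F (F c) + ((-5 : ℚ) : ℂ) • F c + ((4 : ℚ) : ℂ) • c) := by
      rw [hFFc, hFc, hce]
      push_cast
      module
    have he4eq : e4 = (((1 / 6 : ℚ) : ℂ)) • (F (F c) + ((-3 : ℚ) : ℂ) • F c + ((2 : ℚ) : ℂ) • c) := by
      rw [hFFc, hFc, hce]
      push_cast
      module
    have he0eq : e0 = (((1 / 3 : ℚ) : ℂ)) • (F (F c) + ((-6 : ℚ) : ℂ) • F c + ((8 : ℚ) : ℂ) • c) := by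
      rw [hFFc, hFc, hce]
      push_cast
      module
    have hrat2 : IsRationalClass e2 := by
      rw [he2eq]
      exact (((hFrat _ (hFrat _ hc)).add ((hFrat _ hc).smul _)).add (hc.smul _)).smul _
    have hrat4 : IsRationalClass e4 := by
      rw [he4eq]
      exact (((hFrat _ (hFrat _ hc)).add ((hFrat _ hc).smul _)).add (hc.smul _)).smul _
    have hrat0 : IsRationalClass e0 := by
      rw [he0eq]
      exact (((hFrat _ (hFrat _ hc)).add ((hFrat _ hc).smul _)).add (hc.smul _)).smul _
    have htype2 : IsOfHodgeType (1 + 1) (E₁.prod E₂).X 2 1 1 e2 := by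
      rw [he2eq]
      exact (((hFtype _ (hFtype _ hpp)).add hB ((hFtype _ hpp).smul _)).add hB (hpp.smul _)).smul _
    ----------------------------------------------------------------
    -- THE HEART: a rational `(1,1)`-class in `pr₁^*H¹ ∪ pr₂^*H¹` vanishes when `d₁d₂` is not a square
    ----------------------------------------------------------------
    have he2z : e2 = 0 := by
      -- `R = (ψ₁ × ψ₂)^*`
      set Θ : E₁.prod E₂ ⟶ E₁.prod E₂ :=
        AbelianVariety.prodLift (AbelianVariety.fst E₁ E₂ ≫ ψ₁) (AbelianVariety.snd E₁ E₂ ≫ ψ₂) with hΘ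
      have hΘ1 : Θ ≫ AbelianVariety.fst E₁ E₂ = AbelianVariety.fst E₁ E₂ ≫ ψ₁ :=
        AbelianVariety.prodLift_fst _ _
      have hΘ2 : Θ ≫ AbelianVariety.snd E₁ E₂ = AbelianVariety.snd E₁ E₂ ≫ ψ₂ :=
        AbelianVariety.prodLift_snd _ _
      set R := (complexBetti.map Θ.hom.hom.hom 2).hom with hR
      set R1 := (complexBetti.map Θ.hom.hom.hom 1).hom with hR1
      have hR1X : ∀ a, R1 (X1 a) = X1 (T₁ a) := fun a ↦ by rw [hR1, hX1, hcomm Θ _ _ hΘ1 1 a]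
      have hR1Y : ∀ b, R1 (Y1 b) = Y1 (T₂ b) := fun b ↦ by rw [hR1, hY1, hcomm Θ _ _ hΘ2 1 b]
      have hRP : ∀ a b, R (P (X1 a) (Y1 b)) = P (X1 (T₁ a)) (Y1 (T₂ b)) := fun a b ↦ by
        have h1 : R (P (X1 a) (Y1 b)) = P (R1 (X1 a)) (R1 (Y1 b)) := by
          rw [hR, hP, hR1]
          exact cupProduct_map (Motives.AlgPoints.mapContinuous (L := ℂ) Θ.hom.hom.hom) rfl (X1 a) (Y1 b)
        rw [h1, hR1X, hR1Y]
      have hRrat : IsRationalClass (R e2) := hrat2.map _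
      have hRtype : IsOfHodgeType (1 + 1) (E₁.prod E₂).X 2 1 1 (R e2) :=
        htype2.map_of_isSmoothProjective hB hB Θ.hom.hom.hom
      -- the eigenvectors `w± = Tv ± s v` of the two curves
      set w₁p : complexBetti E₁.X 1 := T₁ v₁ + s₁ • v₁ with hw₁p
      set w₁m : complexBetti E₁.X 1 := T₁ v₁ - s₁ • v₁ with hw₁m
      set w₂p : complexBetti E₂.X 1 := T₂ v₂ + s₂ • v₂ with hw₂p
      set w₂m : complexBetti E₂.X 1 := T₂ v₂ - s₂ • v₂ with hw₂m
      have hT₁p : T₁ w₁p = s₁ • w₁p := by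
        rw [hw₁p, map_add, map_smul, hT₁2, smul_add, smul_smul, hs₁2, neg_smul, add_comm]
      have hT₁m : T₁ w₁m = (-s₁) • w₁m := by
        rw [hw₁m, map_sub, map_smul, hT₁2, smul_sub, smul_smul, neg_mul, hs₁2, neg_neg, neg_smul]
        abel
      have hT₂p : T₂ w₂p = s₂ • w₂p := by
        rw [hw₂p, map_add, map_smul, hT₂2, smul_add, smul_smul, hs₂2, neg_smul, add_comm]
      have hT₂m : T₂ w₂m = (-s₂) • w₂m := by
        rw [hw₂m, map_sub, map_smul, hT₂2, smul_sub, smul_smul, neg_mul, hs₂2, neg_neg, neg_smul]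
        abel
      -- every degree-one class of a curve is a combination of `w₊, w₋`
      have hdecw : ∀ {E : AbelianVariety ℂ} {T : complexBetti E.X 1 →ₗ[ℂ] complexBetti E.X 1} {v : complexBetti E.X 1}
          {s : ℂ}, E.dim = 1 → LinearIndependent ℂ ![v, T v] → s ≠ 0 →
          ∀ a : complexBetti E.X 1, ∃ α β : ℂ, a = α • (T v + s • v) + β • (T v - s • v) := by
        intro E T v s hE hli hs a
        haveI : Module.Finite ℂ (complexBetti E.X 1) := finite_complexBetti_abelianVariety E 1
        have hcardE : Fintype.card (Fin 2) = Module.finrank ℂ (complexBetti E.X 1) := by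
          rw [Fintype.card_fin, finrank_complexBetti_one_of_dim_eq_one hE]
        let bE := basisOfLinearIndependentOfCardEqFinrank hli hcardE
        have hbE : ∀ j, bE j = ![v, T v] j := fun j ↦ by rw [coe_basisOfLinearIndependentOfCardEqFinrank]
        have ha := bE.sum_repr a
        rw [Fin.sum_univ_two, hbE, hbE] at ha
        change bE.repr a 0 • v + bE.repr a 1 • T v = a at ha
        obtain ⟨r0, r1, ha'⟩ : ∃ r0 r1 : ℂ, r0 • v + r1 • T v = a := ⟨_, _, ha⟩
        set wp := T v + s • v with hwp
        set wm := T v - s • v with hwm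
        refine ⟨r0 * (2 * s)⁻¹ + r1 * 2⁻¹, -(r0 * (2 * s)⁻¹) + r1 * 2⁻¹, ?_⟩
        rw [← ha']
        have h2 : (2 : ℂ) ≠ 0 := two_ne_zero
        have key : v = (2 * s)⁻¹ • (wp - wm) := by
          rw [show wp - wm = (2 * s) • v by rw [hwp, hwm]; module, smul_smul,
            inv_mul_cancel₀ (mul_ne_zero h2 hs), one_smul]
        have key' : T v = (2 : ℂ)⁻¹ • (wp + wm) := by
          rw [show wp + wm = (2 : ℂ) • T v by rw [hwp, hwm]; module, smul_smul,
            inv_mul_cancel₀ h2, one_smul]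
        rw [key', key]
        module
      -- the four products `π_{±±} = pr₁^* w₁± ∪ pr₂^* w₂±`
      set πpp := P (X1 w₁p) (Y1 w₂p) with hπpp
      set πpm := P (X1 w₁p) (Y1 w₂m) with hπpm
      set πmp := P (X1 w₁m) (Y1 w₂p) with hπmp
      set πmm := P (X1 w₁m) (Y1 w₂m) with hπmm
      have hRpp : R πpp = (s₁ * s₂) • πpp := by
        rw [hπpp, hRP, hT₁p, hT₂p, map_smul, map_smul, map_smul, LinearMap.smul_apply, map_smul, smul_smul]
      have hRpm : R πpm = (-(s₁ * s₂)) • πpm := by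
        rw [hπpm, hRP, hT₁p, hT₂m, map_smul, map_smul, map_smul, LinearMap.smul_apply, map_smul, smul_smul,
          mul_neg]
      have hRmp : R πmp = (-(s₁ * s₂)) • πmp := by
        rw [hπmp, hRP, hT₁m, hT₂p, map_smul, map_smul, map_smul, LinearMap.smul_apply, map_smul, smul_smul,
          neg_mul]
      have hRmm : R πmm = (s₁ * s₂) • πmm := by
        rw [hπmm, hRP, hT₁m, hT₂m, map_smul, map_smul, map_smul, LinearMap.smul_apply, map_smul, smul_smul,
          neg_mul_neg]
      -- `E2 ≤ span {π's}`, so `e2 = Σ cf i • π i`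
      set S : Submodule ℂ (complexBetti (E₁.prod E₂).X 2) :=
        Submodule.span ℂ (Set.range ![πpp, πpm, πmp, πmm]) with hSdef
      have hπS : πpp ∈ S ∧ πpm ∈ S ∧ πmp ∈ S ∧ πmm ∈ S :=
        ⟨Submodule.subset_span ⟨0, rfl⟩, Submodule.subset_span ⟨1, rfl⟩, Submodule.subset_span ⟨2, rfl⟩,
          Submodule.subset_span ⟨3, rfl⟩⟩
      have hE2S : E2 ≤ S := by
        rw [hE2]
        refine Submodule.span_le.2 ?_
        rintro _ ⟨a, b, rfl⟩
        obtain ⟨α, β, ha⟩ := hdecw hE₁ hli₁ hs₁0 a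
        obtain ⟨γ, δ, hb⟩ := hdecw hE₂ hli₂ hs₂0 b
        rw [ha, hb]
        change P (X1 (α • w₁p + β • w₁m)) (Y1 (γ • w₂p + δ • w₂m)) ∈ S
        simp only [map_add, map_smul, LinearMap.add_apply, LinearMap.smul_apply]
        change γ • (α • πpp + β • πmp) + δ • (α • πpm + β • πmm) ∈ S
        exact Submodule.add_mem _
          (Submodule.smul_mem _ _ (Submodule.add_mem _ (Submodule.smul_mem _ _ hπS.1)
            (Submodule.smul_mem _ _ hπS.2.2.1)))
          (Submodule.smul_mem _ _ (Submodule.add_mem _ (Submodule.smul_mem _ _ hπS.2.1)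
            (Submodule.smul_mem _ _ hπS.2.2.2)))
      obtain ⟨cf, hcf⟩ := (Submodule.mem_span_range_iff_exists_fun ℂ).1 (hE2S he2)
      rw [Fin.sum_univ_four] at hcf
      change cf 0 • πpp + cf 1 • πpm + cf 2 • πmp + cf 3 • πmm = e2 at hcf
      have hRe2 : R e2 = (cf 0 * (s₁ * s₂)) • πpp + (cf 1 * (-(s₁ * s₂))) • πpm +
          (cf 2 * (-(s₁ * s₂))) • πmp + (cf 3 * (s₁ * s₂)) • πmm := by
        rw [← hcf]
        simp only [map_add, map_smul, hRpp, hRpm, hRmp, hRmm, smul_smul]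
      -- Hodge types of the four products (Künneth for Hodge types, de Rham multiplicative)
      have hdR : ∀ (E : Type) [NormedAddCommGroup E] [NormedSpace ℂ E] [FiniteDimensional ℂ E],
          Literature.NumberTheory.Transcendental.exists_deRhamIsoFamily (modelWithCornersSelf ℝ E) :=
        fun E _ _ _ ↦ Literature.NumberTheory.Transcendental.exists_deRhamIsoFamily_holds E
      have htpp : IsOfHodgeType (1 + 1) (E₁.prod E₂).X 2 (p₁ + p₂) (q₁ + q₂) πpp :=
        isOfHodgeType_cupProduct_map_fst_map_snd_of_multiplicative_deRham hdR E₁ E₂ 1 1 hE₁ hE₂ 1 1 2 rfl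
          p₁ q₁ p₂ q₂ w₁p w₂p hwp₁ hwp₂
      have htpm : IsOfHodgeType (1 + 1) (E₁.prod E₂).X 2 (p₁ + q₂) (q₁ + p₂) πpm :=
        isOfHodgeType_cupProduct_map_fst_map_snd_of_multiplicative_deRham hdR E₁ E₂ 1 1 hE₁ hE₂ 1 1 2 rfl
          p₁ q₁ q₂ p₂ w₁p w₂m hwp₁ hwm₂
      have htmp : IsOfHodgeType (1 + 1) (E₁.prod E₂).X 2 (q₁ + p₂) (p₁ + q₂) πmp :=
        isOfHodgeType_cupProduct_map_fst_map_snd_of_multiplicative_deRham hdR E₁ E₂ 1 1 hE₁ hE₂ 1 1 2 rfl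
          q₁ p₁ p₂ q₂ w₁m w₂p hwm₁ hwp₂
      have htmm : IsOfHodgeType (1 + 1) (E₁.prod E₂).X 2 (q₁ + q₂) (p₁ + p₂) πmm :=
        isOfHodgeType_cupProduct_map_fst_map_snd_of_multiplicative_deRham hdR E₁ E₂ 1 1 hE₁ hE₂ 1 1 2 rfl
          q₁ p₁ q₂ p₂ w₁m w₂m hwm₁ hwm₂
      have hss : (s₁ * s₂) * (s₁ * s₂) = (d₁ : ℂ) * d₂ := by
        calc (s₁ * s₂) * (s₁ * s₂) = (s₁ * s₁) * (s₂ * s₂) := by ring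
          _ = (d₁ : ℂ) * d₂ := by rw [hs₁2, hs₂2]; ring
      -- `R e2 = μ e2` with `μ = ∓ s₁ s₂`, by Hodge types
      obtain ⟨μ, hμ2, hμ⟩ : ∃ μ : ℂ, μ * μ = (d₁ : ℂ) * d₂ ∧ R e2 = μ • e2 := by
        by_cases hp : p₁ = p₂
        · -- `(1,1)`-products: `π₊₋, π₋₊` (eigenvalue `-s₁s₂`); `π₊₊`, `π₋₋` have types `(2p₁,2q₁)`, `(2q₁,2p₁)`
          refine ⟨-(s₁ * s₂), by rw [neg_mul_neg, hss], ?_⟩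
          have e1 : p₁ + p₂ = 2 * p₁ := by omega
          have e2' : q₁ + q₂ = 2 * q₁ := by omega
          have hy : R e2 - (-(s₁ * s₂)) • e2 =
              (cf 0 * (2 * (s₁ * s₂))) • πpp + (cf 3 * (2 * (s₁ * s₂))) • πmm := by
            rw [hRe2, ← hcf]
            module
          have h1 : IsOfHodgeType (1 + 1) (E₁.prod E₂).X 2 (2 * p₁) (2 * q₁)
              ((cf 0 * (2 * (s₁ * s₂))) • πpp) := by
            have h := htpp.smul (cf 0 * (2 * (s₁ * s₂)))
            rw [e1, e2'] at h
            exact h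
          have h2 : IsOfHodgeType (1 + 1) (E₁.prod E₂).X 2 (2 * q₁) (2 * p₁)
              ((cf 3 * (2 * (s₁ * s₂))) • πmm) := by
            have h := htmm.smul (cf 3 * (2 * (s₁ * s₂)))
            rw [e1, e2'] at h
            exact h
          have hysum : IsOfHodgeType (1 + 1) (E₁.prod E₂).X 2 1 1
              ((cf 0 * (2 * (s₁ * s₂))) • πpp + (cf 3 * (2 * (s₁ * s₂))) • πmm) := by
            rw [← hy]
            exact hRtype.sub hB (htype2.smul _)
          have hzero := IsOfHodgeType.add_eq_zero_of_ne hB h1 h2 hysum (by omega) (by omega) rfl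
            (by simp only [ne_eq, Prod.mk.injEq]; omega) (by simp only [ne_eq, Prod.mk.injEq]; omega)
          rw [← hy] at hzero
          exact sub_eq_zero.1 hzero
        · -- `(1,1)`-products: `π₊₊, π₋₋` (eigenvalue `s₁s₂`); `π₊₋`, `π₋₊` have types `(2p₁,2q₁)`, `(2q₁,2p₁)`
          refine ⟨s₁ * s₂, hss, ?_⟩
          have e1 : p₁ + q₂ = 2 * p₁ := by omega
          have e2' : q₁ + p₂ = 2 * q₁ := by omega
          have hy : R e2 - (s₁ * s₂) • e2 =
              (cf 1 * (-(2 * (s₁ * s₂)))) • πpm + (cf 2 * (-(2 * (s₁ * s₂)))) • πmp := by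
            rw [hRe2, ← hcf]
            module
          have h1 : IsOfHodgeType (1 + 1) (E₁.prod E₂).X 2 (2 * p₁) (2 * q₁)
              ((cf 1 * (-(2 * (s₁ * s₂)))) • πpm) := by
            have h := htpm.smul (cf 1 * (-(2 * (s₁ * s₂))))
            rw [e1, e2'] at h
            exact h
          have h2 : IsOfHodgeType (1 + 1) (E₁.prod E₂).X 2 (2 * q₁) (2 * p₁)
              ((cf 2 * (-(2 * (s₁ * s₂)))) • πmp) := by
            have h := htmp.smul (cf 2 * (-(2 * (s₁ * s₂))))
            rw [e2', e1] at h
            exact h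
          have hysum : IsOfHodgeType (1 + 1) (E₁.prod E₂).X 2 1 1
              ((cf 1 * (-(2 * (s₁ * s₂)))) • πpm + (cf 2 * (-(2 * (s₁ * s₂)))) • πmp) := by
            rw [← hy]
            exact hRtype.sub hB (htype2.smul _)
          have hzero := IsOfHodgeType.add_eq_zero_of_ne hB h1 h2 hysum (by omega) (by omega) rfl
            (by simp only [ne_eq, Prod.mk.injEq]; omega) (by simp only [ne_eq, Prod.mk.injEq]; omega)
          rw [← hy] at hzero
          exact sub_eq_zero.1 hzero
      -- a rational class cannot be an eigenvector for the IRRATIONAL eigenvalue `μ` (`μ² = d₁d₂`)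
      by_contra hne
      have hratfam : ∀ j, IsRationalClass ((![e2, R e2] : Fin 2 → complexBetti (E₁.prod E₂).X 2) j) := by
        intro j
        fin_cases j
        · exact hrat2
        · exact hRrat
      have hdep : ¬ LinearIndependent ℂ ![e2, R e2] := by
        intro hli
        have h := (LinearIndependent.pair_iff.1 hli) μ (-1) (by rw [hμ, neg_one_smul, add_neg_cancel])
        exact one_ne_zero (neg_eq_zero.1 h.2)
      rw [linearIndependent_iff_of_isRationalClass hratfam] at hdep
      obtain ⟨q, hq⟩ := not_forall.1 hdep
      obtain ⟨hq1, hq2⟩ := Classical.not_imp.1 hq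
      rw [Fin.sum_univ_two] at hq1
      change ((q 0 : ℚ) : ℂ) • e2 + ((q 1 : ℚ) : ℂ) • R e2 = 0 at hq1
      rw [hμ, smul_smul, ← add_smul] at hq1
      have hcoef : ((q 0 : ℚ) : ℂ) + ((q 1 : ℚ) : ℂ) * μ = 0 := (smul_eq_zero.1 hq1).resolve_right hne
      have hq1ne : q 1 ≠ 0 := by
        intro h0
        apply hq2
        funext j
        fin_cases j
        · have : ((q 0 : ℚ) : ℂ) = 0 := by simpa [h0] using hcoef
          exact_mod_cast this
        · exact h0
      have hq1neC : ((q 1 : ℚ) : ℂ) ≠ 0 := by exact_mod_cast hq1ne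
      have hμq : μ = -(((q 0 : ℚ) : ℂ) / ((q 1 : ℚ) : ℂ)) := by
        field_simp
        linear_combination hcoef
      have hsqC : (((d₁ * d₂ : ℕ) : ℚ) : ℂ) = (((q 0 / q 1) ^ 2 : ℚ) : ℂ) := by
        push_cast
        rw [← hμ2, hμq]
        ring
      have hsqQ : ((d₁ * d₂ : ℕ) : ℚ) = (q 0 / q 1) ^ 2 := by exact_mod_cast hsqC
      exact hsq (Rat.isSquare_natCast_iff.1 ⟨q 0 / q 1, by rw [hsqQ, sq]⟩)
    -- assembly: `c = pr₁^* a ∪ pr₂^* 1 + pr₁^* 1 ∪ pr₂^* b`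
    obtain ⟨a, rfl⟩ := he4
    obtain ⟨b, rfl⟩ := he0
    have ha : IsRationalClass a := by
      have h : IsRationalClass ((complexBetti.map (AbelianVariety.prodLift (𝟙 E₁) (0 : E₁ ⟶ E₂)).hom.hom.hom
        2).hom (X2 a)) := hrat4.map _
      rwa [hX2, sliceLeft_map_fst] at h
    have hb : IsRationalClass b := by
      have h : IsRationalClass ((complexBetti.map (AbelianVariety.prodLift (0 : E₂ ⟶ E₁) (𝟙 E₂)).hom.hom.hom
        2).hom (Y2 b)) := hrat0.map _
      rwa [hY2, sliceRight_map_snd] at h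
    have hXa : cupProduct (X := Motives.ComplexPoints (E₁.X ⊗ E₂.X)) (two_mul_add_two_mul 1 0)
        ((complexBetti.map (AbelianVariety.fst E₁ E₂).hom.hom.hom (2 * 1)).hom a)
        ((complexBetti.map (AbelianVariety.snd E₁ E₂).hom.hom.hom (2 * 0)).hom
          (singularCohomology.one ℂ (Motives.ComplexPoints E₂.X))) = X2 a := by
      change cupProduct (p := 2) (q := 0) (n := 2) _ (X2 a)
        (singularCohomology.map ℂ ℂ _ 0 (singularCohomology.one ℂ _)) = _
      rw [singularCohomology.map_one]
      exact cupProduct_one _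
    have hYb : cupProduct (X := Motives.ComplexPoints (E₁.X ⊗ E₂.X)) (two_mul_add_two_mul 0 1)
        ((complexBetti.map (AbelianVariety.fst E₁ E₂).hom.hom.hom (2 * 0)).hom
          (singularCohomology.one ℂ (Motives.ComplexPoints E₁.X)))
        ((complexBetti.map (AbelianVariety.snd E₁ E₂).hom.hom.hom (2 * 1)).hom b) = Y2 b := by
      change cupProduct (p := 0) (q := 2) (n := 2) _
        (singularCohomology.map ℂ ℂ _ 0 (singularCohomology.one ℂ _)) (Y2 b) = _
      rw [singularCohomology.map_one]
      exact one_cupProduct _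
    rw [hce, he2z, add_zero]
    refine Submodule.add_mem _ ?_ ?_
    · have h := smul_cupProduct_mem_span_hodgeProductClasses (p := 1) (two_mul_add_two_mul 1 0) ha
        (isOfHodgeType_two_of_dim_eq_one hE₁ a) hone₂ hone₂' 1
      rw [hXa, one_smul] at h
      exact h
    · have h := smul_cupProduct_mem_span_hodgeProductClasses (p := 1) (two_mul_add_two_mul 0 1) hone₁
        hone₁' hb (isOfHodgeType_two_of_dim_eq_one hE₂ b) 1
      rw [hYb, one_smul] at h
      exact h
  · ----------------------------------------------------------------
    -- `p = 2`: `H⁴(B)` is the line through `pr₁^*(v₁ ∪ T₁v₁) ∪ pr₂^*(v₂ ∪ T₂v₂) ≠ 0`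
    ----------------------------------------------------------------
    change ↥(complexBetti (E₁.prod E₂).X 4) at c
    set a₁ := P₁ v₁ (T₁ v₁) with ha₁def
    set a₂ := P₂ v₂ (T₂ v₂) with ha₂def
    have ha₁ : IsRationalClass a₁ := hv₁.cup rfl (hv₁.map _)
    have ha₂ : IsRationalClass a₂ := hv₂.cup rfl (hv₂.map _)
    set w := cupProduct (X := Motives.ComplexPoints (E₁.prod E₂).X) (R := ℂ) (rfl : 2 + 2 = 4)
      (X2 a₁) (Y2 a₂) with hw
    -- `w` is the four-fold product of the basis `bB`
    have hbBf : ⇑bB = ![X1 v₁, X1 (T₁ v₁), Y1 v₂, Y1 (T₂ v₂)] :=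
      coe_basisOfLinearIndependentOfCardEqFinrank hliB hcard
    have hw4 : cupPowOne ℂ (Motives.ComplexPoints (E₁.prod E₂).X) 4 ⇑bB = w := by
      rw [hbBf, cupPowOne_succ, Fin.tail_def, cupPowOne_succ, Fin.tail_def, hP2]
      change cupProduct (Nat.add_comm 1 3) (X1 v₁)
          (cupProduct (Nat.add_comm 1 2) (X1 (T₁ v₁)) (P (Y1 v₂) (Y1 (T₂ v₂)))) = w
      rw [hPYY, hw, ← hPXX]
      exact (cupProduct_assoc (rfl : 1 + 1 = 2) (rfl : 1 + 2 = 3) (rfl : 2 + 2 = 4) (rfl : 1 + 3 = 4)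
        (X1 v₁) (X1 (T₁ v₁)) (Y2 a₂)).symm
    have hw0 : w ≠ 0 := by
      intro h0
      have h1 : wedgeToCup ℂ (Motives.ComplexPoints (E₁.prod E₂).X) 4
          (exteriorPower.ιMulti ℂ 4 ⇑bB) = 0 := by
        rw [wedgeToCup_ιMulti, hw4, h0]
      have h2 : exteriorPower.ιMulti ℂ 4 ⇑bB = 0 := hΛ.eq_zero_of_wedgeToCup_eq_zero h1
      have h3 : exteriorPower.alternatingMapLinearEquiv bB.det (exteriorPower.ιMulti ℂ 4 ⇑bB) =
          bB.det ⇑bB := exteriorPower.alternatingMapLinearEquiv_apply_ιMulti _ _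
      rw [h2, map_zero, Module.Basis.det_self] at h3
      exact zero_ne_one h3
    -- `H⁴(B)` is a line
    haveI : Module.Finite ℂ (complexBetti (E₁.prod E₂).X 4) := hfin 4
    have hfin4 : Module.finrank ℂ (complexBetti (E₁.prod E₂).X 4) = 1 := by
      have h := hΛ.finrank_eq 4
      rw [hb1, Nat.choose_self] at h
      exact h
    obtain ⟨t, ht⟩ := (finrank_eq_one_iff_of_nonzero' w hw0).1 hfin4 c
    rw [← ht, hw]
    exact smul_cupProduct_mem_span_hodgeProductClasses (p := 2) (two_mul_add_two_mul 1 1) ha₁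
      (isOfHodgeType_two_of_dim_eq_one hE₁ a₁) ha₂ (isOfHodgeType_two_of_dim_eq_one hE₂ a₂) t
  · ----------------------------------------------------------------
    -- `p ≥ 3`: `H^{2p}(B) = 0`
    ----------------------------------------------------------------
    have hc0 : c = 0 := by
      haveI := hΛ.subsingleton_of_lt (d := 2 * p) (by rw [hb1]; omega)
      exact Subsingleton.elim _ _
    rw [hc0]
    exact Submodule.zero_mem _

/-- **The CM-curve dichotomy, both sides in the kernel**: there are elliptic curves `E₁`, `E₂` with
complex multiplication (both of CM type; `ψ₁² = -1`, `ψ₂² = -2`, fields `ℚ(i) ≠ ℚ(√-2)`) such that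
the Hodge classes of `E₁ × E₂` ARE spanned by the products of Hodge classes of the factors
(`hodgeClassesProductSpan_cmCurves`: `Hom(E₁, E₂) = 0`, Moonen–Zarhin (3.1)/(3.9)), while those
of `E₁ × E₁` are NOT (`not_hodgeClassesProductSpan_cmSquare`: `Hom(E₁, E₁) ≠ 0`).
[cite: MoonenZarhin1999LowDim, §3 (3.1) and Cor. (3.9)] -/
theorem exists_cmCurves_productSpan_and_not_productSpan :
    ∃ (E₁ E₂ : AbelianVariety ℂ), Milne1999.IsOfCMType E₁ ∧ Milne1999.IsOfCMType E₂ ∧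
      HodgeClassesProductSpan E₁ E₂ ∧ ¬ HodgeClassesProductSpan E₁ E₁ := by
  obtain ⟨E₁, ψ₁, hE₁, hψ₁⟩ :=
    Literature.NumberTheory.EllipticCurves.CMEndomorphism.exists_cmCurve_sqrt_neg 1 one_pos
  obtain ⟨E₂, ψ₂, hE₂, hψ₂⟩ :=
    Literature.NumberTheory.EllipticCurves.CMEndomorphism.exists_cmCurve_sqrt_neg 2 two_pos
  exact ⟨E₁, E₂, isOfCMType_of_cmCurve hE₁ one_pos hψ₁, isOfCMType_of_cmCurve hE₂ two_pos hψ₂,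
    hodgeClassesProductSpan_cmCurves hE₁ hE₂ hψ₁ hψ₂ (by
      rintro ⟨r, hr⟩
      have hr2 : r ≤ 2 := by nlinarith
      interval_cases r <;> omega),
    not_hodgeClassesProductSpan_cmSquare hE₁ one_pos hψ₁⟩

end Main

end Literature.AlgebraicGeometry.HodgeTheory

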